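import Mathlib
import HarnessLib
import Summits.HubbardSuperconductivity.HubbardSuperconductivity.Theorems.KLProgrammeKLRegimeEngineTowerLevNumericsDoors

/-!
# Route `KLProgramme` — crux K3 ENGINE (stmt-HubbardSuperconductivity-20437 `KLRegimeEngineV17F2`), stub (b) v2, THE LEVELS PACKAGE (ℓ), numerics side
# «(ℓ)-NUMERICS» part 3b-R (cell gate-hubbard-kl, seat p4 g21): THE NUMERICS PACKAGE ON THE ROWS ASSEMBLY — base datum as SHAPED ROWS `Ab = ab·(β/M)`,
# `Qb = qb·(M/β)²` (p3 g22's «(ℓ)-REKEY-ROWS» / F9 `exists_levelZeroBaseRows_klEng` shape), no grid step, hence NO `hθ` row and NO frame weight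

Keyed on `kernelNormsLevels_all_klEng_final_rows (c″)` (p698561): the main tower's base datum is an abstract pair `(Ab, Qb)` with the unit law at `λ_d`, so the
numerics need only the SHAPES `Ab = ab·(β/M)` (`ab > 0`) and `Qb = qb·(M/β)²` (`qb > 0`) — exactly what the level-datum suppliers deliver (`A₁·ε_x/Klam²`,
`P₁/ε_x²`) — plus the link pins, the imports `ι₁ ≤ i₁(M/β)`, `ι₂ ≤ i₂(M/β)³`, `X ≤ x₆(M/β)⁵` and the assembly's derived binders.  Closed forms (equational, `rfl`):
pins `W₀ Z₀ s₀ t₀ p₀ φ₀ ρk₀ κA₀`, `QL = Z₀·qb`, `QH = Z₀·qb + 1`, `yB aPB i₃B sCB`, **`Bf`**, `yP yL aP aA aL i₃c sC Sfive R₆ R₇`,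
**`uf = min 1 (min (1/(8s₀QH+1)) (… (1/(R₇+1))))`** (NO θ-door), `qT aT`, **`CEf = qT·Bf·max 1 (2aT)`**.
**`levNumerics_packageR`**: `1 ≤ Bf ∧ 0 < uf ∧ 0 ≤ CEf` and, for all `0 < β ≤ M`, `0 < U ≤ uf`, shaped `Ab Qb`, imports, derived binders at `B := Bf`:
(ii) the `B ≥ B₀` row `≤ Bf`; (iii) `uf ≤` the doors' seven-term `min`; (iv) for every `0 ≤ λ ≤ uf`, the CE♯ row `≤ CEf`.
Pure real arithmetic (composition of …NumericsPins/Bounds/Doors); nothing about the model is asserted; nothing asserts (ℓ), any stub, K3 or superconductivity.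
References: BGM 2006 §2.8 (2.83)–(2.84), (2.93)–(2.98), Lemma 2.5 (2.98) [cite: BenfattoGiulianiMastropietro2006].
-/

noncomputable section

namespace Summit.HubbardSuperconductivity.HubbardSuperconductivity.Theorems.EngineV8

set_option linter.dupNamespace false -- summit = problem name (single-conjunct summit), D-0017

open Real Literature.MathematicalPhysics.QuantumLattice
open Summit.HubbardSuperconductivity.HubbardSuperconductivity.Theorems.KLRegimeSplit

set_option maxHeartbeats 1600000 in -- one ~60-binder statement, ~40 constants (measured need: between 400k and 800k; cap with margin)
/-- **THE NUMERICS PACKAGE OF THE LEVELS CLAUSE** (see the module docstring for the list of closed forms and the four conclusions).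
[cite: BenfattoGiulianiMastropietro2006, §2.8 (2.77)-(2.84), (2.93)-(2.98), Lemma 2.5 (2.98)] -/
theorem levNumerics_packageR
    {C₁ C₂ C₁' C₂' Cinc Dinc Cκ Cb CJ Klam ab qb i₁ i₂ x₆ : ℝ} {d : ℕ}
    (hC₁ : 0 < C₁) (hC₂ : 0 < C₂) (hC₁' : 0 < C₁') (hC₂' : 0 < C₂') (hCinc : 0 < Cinc) (hDinc : 1 ≤ Dinc)
    (hCκ : 0 < Cκ) (hCb : 0 < Cb) (hCJ : 0 < CJ) (hKlam : 1 ≤ Klam) (hd : 2 ≤ d)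
    (hab0 : 0 < ab) (hqb0 : 0 < qb) (hi₁ : 0 ≤ i₁) (hi₂ : 0 ≤ i₂) (hx₆ : 0 ≤ x₆)
    -- the r-free closed forms (instantiate with `rfl`)
    {W₀ Z₀ s₀ t₀ p₀ φ₀ ρk₀ κA₀ QL QH yB aPB i₃B sCB Bf yP yL aP aA aL i₃c sC Sfive R₆ R₇ uf qT aT CEf : ℝ}
    (hW₀ : W₀ = 32 * (27 : ℝ) ^ 4 * exp 2) (hZ₀ : Z₀ = exp 4 * (81 * CJ) ^ 2 / 8)
    (hs₀ : s₀ = 2 * Cκ * klE0 / (exp 4 * 162 ^ 2 * CJ ^ 2)) (ht₀ : t₀ = exp 2 * (2 * Cκ * klE0) / (162 ^ 2 * CJ ^ 2))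
    (hp₀ : p₀ = exp 4 * 162 ^ 2 * CJ ^ 2 / (2 * Cκ * klE0)) (hφ₀ : φ₀ = 9 * Cb * (4 : ℝ) ^ d / ((27 : ℝ) ^ 5 * exp 1 * Cκ * klE0 ^ 2))
    (hρk₀ : ρk₀ = 2 * exp 6) (hκA₀ : κA₀ = W₀ * ((27 : ℝ) ^ 5 * (C₁ / C₂) * (8 : ℝ) ^ (d - 1)))
    (hQL : QL = Z₀ * qb) (hQH : QH = Z₀ * qb + 1)
    (hyB : yB = i₂ / (2 * QL) + W₀ * Z₀ ^ 3 * x₆ / (4 * QL ^ 2) + (W₀ * (27 : ℝ) ^ 5 + κA₀) * ab * QH / 2)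
    (haPB : aPB = (W₀ * (27 : ℝ) ^ 5 + κA₀) * ab + 2 * yB / QL) (hi₃B : i₃B = W₀ * Z₀ ^ 3 * x₆ + aPB * QH ^ 3)
    (hsCB : sCB = i₂ / (2 * QL) + i₃B / (4 * QL ^ 2) + aPB * QH / 4)
    (hBf : Bf = max (max 1 (max (8 * φ₀ * t₀ * yB) (512 * exp 1 * p₀ ^ 3 * t₀ ^ 4 * φ₀ * κA₀ * yB / (3 * ρk₀ ^ 3)))) (4 * φ₀ * t₀ * sCB))
    (hyP : yP = i₂ / (2 * Bf * QL) + W₀ * Z₀ ^ 3 * x₆ / (4 * Bf ^ 2 * QL ^ 2) + (W₀ * (27 : ℝ) ^ 5 + κA₀) * ab * QH / (2 * Bf ^ 2))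
    (hyL : yL = (W₀ * (27 : ℝ) ^ 5 + κA₀) * ab * QL / (2 * Bf ^ 2))
    (haP : aP = (W₀ * (27 : ℝ) ^ 5 + κA₀) * ab / Bf ^ 2 + 2 * yP / QL) (haA : aA = 2 * yP / (κA₀ * QL)) (haL : aL = 3 * yL / (2 * κA₀ * QH))
    (hi₃c : i₃c = W₀ * Z₀ ^ 3 * x₆ / Bf ^ 2 + aP * QH ^ 3) (hsC : sC = i₂ / (2 * Bf * QL) + i₃c / (4 * QL ^ 2) + aP * QH / 4)
    (hSfive : Sfive = exp 1 * φ₀ * t₀ * i₁ + exp 1 ^ 2 * φ₀ * t₀ ^ 2 * (i₂ / Bf) + exp 1 ^ 3 * φ₀ * t₀ ^ 3 * i₃c + φ₀ * aP * exp 1 ^ 2 * t₀ ^ 2 * QH ^ 2 / 2)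
    (hR₆ : R₆ = 1024 * s₀ * aP * QH / (aL * ρk₀ ^ 3)) (hR₇ : R₇ = 64 * exp 1 * p₀ ^ 3 * t₀ ^ 4 * φ₀ * QH ^ 2 * i₁ ^ 2 / (aL * ρk₀ ^ 3 * QL ^ 3))
    (huf : uf = min 1 (min (1 / (8 * s₀ * QH + 1)) (min (1 / (2 * exp 1 * t₀ * QH + 1)) (min (1 / (4 * φ₀ * t₀ * i₁ + 1))
      (min (1 / (2 * Sfive + 1)) (min (1 / (R₆ + 1)) (1 / (R₇ + 1))))))))
    (hqT : qT = Dinc * (1 + C₂' ^ 2 * (2 * qb + ρk₀ * QH) + 4 * QH + 2 * t₀ * p₀ * QH) / 4)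
    (haT : aT = (27 : ℝ) ^ 5 * (C₁' / C₂') * (ab / Bf ^ 2 + 4 / 3 * (8 : ℝ) ^ (d - 1) * aA) + Cinc * (aP + exp 1 * (i₁ + sC) / (2 * QL)))
    (hCEf : CEf = qT * Bf * max 1 (2 * aT)) :
    1 ≤ Bf ∧ 0 < uf ∧ 0 ≤ CEf ∧
    ∀ (β : ℝ) (M : ℕ) [NeZero M], 0 < β → β ≤ M → ∀ U : ℝ, 0 < U → U ≤ uf →
    -- the base datum's SHAPED ROWS, E1's imports ON THE SHAPES, and the derived primed binders at `B := Bf`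
    ∀ (Ab Qb ι₂ X : ℝ), Ab = ab * (β / M) → Qb = qb * ((M : ℝ) / β) ^ 2 → 0 ≤ ι₂ → ι₂ ≤ i₂ * ((M : ℝ) / β) ^ 3 → 0 ≤ X → X ≤ x₆ * ((M : ℝ) / β) ^ 5 →
    ∀ (Ab' ι₂' X' : ℝ), Ab' = Ab / Bf ^ 2 → ι₂' = ι₂ / Bf → X' = X / Bf ^ 2 →
    -- the link pins and the law's six names (equational), the import `ι₁` ON ITS SHAPE
    ∀ (κb αb crb ccb : ℝ), κb = Real.sqrt (2 * Cκ * klE0) → αb = Cb * ((M : ℝ) / β) * (4 : ℝ) ^ d / klE0 →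
      crb = 81 * CJ * M / β → ccb = 162 * CJ * M / β →
    ∀ (W Z σ Φ ψ τ ι₁ : ℝ), W = 64 * (27 : ℝ) ^ 4 * exp 2 * crb / ccb → Z = exp 4 * ccb ^ 2 * imagTimeWeight β M ^ 2 / 8 →
      σ = κb ^ 2 / (exp 4 * ccb ^ 2) → Φ = 9 * αb * ccb / ((27 : ℝ) ^ 5 * exp 1 * κb ^ 2 * crb) → ψ = exp 4 * ccb ^ 2 / κb ^ 2 →
      τ = exp 2 * κb ^ 2 / ccb ^ 2 → 0 ≤ ι₁ → ι₁ ≤ i₁ * ((M : ℝ) / β) →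
    ∀ (ρk Q' Q κA Yb Y A A' ι₃ : ℝ), ρk = max 4 (2 * τ * ψ) → Q' = Z * Qb + 1 → Q = ρk * Q' →
      κA = W * ((27 : ℝ) ^ 5 * (C₁ / C₂) * (8 : ℝ) ^ (d - 1)) →
      Yb = ι₂ / (2 * Q') + W * Z ^ 3 * X / (4 * Q' ^ 2) + (W * (27 : ℝ) ^ 5 * Ab + κA * Ab) * Q' / 2 →
      Y = ι₂' / (2 * Q') + W * Z ^ 3 * X' / (4 * Q' ^ 2) + (W * (27 : ℝ) ^ 5 * Ab' + κA * Ab') * Q' / 2 →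
      A = 2 * Y * (1 - ((2 : ℝ) ^ d)⁻¹) / (κA * Q') →
      A' = (W * (27 : ℝ) ^ 5 * Ab' + κA * Ab') + 2 * Y / Q' → ι₃ = W * Z ^ 3 * X' + A' * Q' ^ 3 →
    -- (ii) the `B ≥ B₀` row, (iii) the doors, (iv) the CE♯ row at every level
    max 1 (max (8 * Φ * τ * Yb) (128 * exp 1 * ψ ^ 3 * τ ^ 4 * Φ * κA * Yb / ((1 - ((2 : ℝ) ^ d)⁻¹) * ρk ^ 3))) ≤ Bf ∧
    uf ≤ min 1 (min (1 / (8 * σ * Q' + 1)) (min (1 / (2 * exp 1 * τ * Q' + 1)) (min (1 / (4 * Φ * τ * ι₁ + 1))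
        (min (1 / (2 * (Φ * (exp 1 * τ * ι₁ + (exp 1 * τ) ^ 2 * ι₂' + (exp 1 * τ) ^ 3 * ι₃ + A' * (exp 1 * τ * Q') ^ 2 / 2)) + 1))
          (min (A * Q ^ 3 / (16 * σ * Q' * A' * (4 * Q') ^ 3 + A * Q ^ 3))
            (A * Q ^ 3 / (16 * exp 1 * ψ * (2 * τ * ψ * Q') ^ 2 * Φ * τ ^ 2 * ι₁ ^ 2 + A * Q ^ 3))))))) ∧
    (∀ lam : ℝ, 0 ≤ lam → lam ≤ uf → ∀ (Aro Qro Qtot Atot : ℝ),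
      Aro = (27 : ℝ) ^ 5 * (C₁' / C₂') * (Ab' + (8 : ℝ) ^ (d - 1) * (A / (1 - ((2 : ℝ) ^ d)⁻¹))) →
      Qro = C₂' ^ 2 * max Qb (((2 : ℝ) ^ (d - 1))⁻¹ * max Q Qb) → Qtot = Dinc * max 1 (max Qro (max (4 * Q') (2 * τ * ψ * Q'))) →
      Atot = Aro + Cinc * (A' * (4 * σ * lam * Q' / (1 - 4 * σ * lam * Q')) +
          exp 1 * (τ * (ι₁ * lam + ι₂' / (2 * Q') + ι₃ / (4 * Q' ^ 2) + A' * Q' / 4)) *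
            (Φ * (τ * (ι₁ * lam + ι₂' / (2 * Q') + ι₃ / (4 * Q' ^ 2) + A' * Q' / 4)) /
              (1 - Φ * (τ * (ι₁ * lam + ι₂' / (2 * Q') + ι₃ / (4 * Q' ^ 2) + A' * Q' / 4)))) / (2 * τ * Q')) →
      Qtot * imagTimeWeight β M ^ 2 * Bf * max 1 (Atot / imagTimeWeight β M) ≤ CEf) := by
  -- §0 positivity of the r-free closed forms
  have he0 : (0 : ℝ) < klE0 := by norm_num [klE0]
  have hW₀0 : 0 < W₀ := by rw [hW₀]; positivity
  have hZ₀0 : 0 < Z₀ := by rw [hZ₀]; positivity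
  have hs₀0 : 0 < s₀ := by rw [hs₀]; positivity
  have ht₀0 : 0 < t₀ := by rw [ht₀]; positivity
  have hp₀0 : 0 < p₀ := by rw [hp₀]; positivity
  have hφ₀0 : 0 < φ₀ := by rw [hφ₀]; positivity
  have hρk₀0 : 0 < ρk₀ := by rw [hρk₀]; positivity
  have hκA₀0 : 0 < κA₀ := by rw [hκA₀]; positivity
  have hKlam0 : 0 < Klam := lt_of_lt_of_le one_pos hKlam
  have hQL0 : 0 < QL := by rw [hQL]; positivity
  have hQH0 : 0 < QH := by rw [hQH]; positivity
  have hyB0 : 0 ≤ yB := by rw [hyB]; positivity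
  have haPB0 : 0 ≤ aPB := by rw [haPB]; positivity
  have hi₃B0 : 0 ≤ i₃B := by rw [hi₃B]; positivity
  have hsCB0 : 0 ≤ sCB := by rw [hsCB]; positivity
  have hBf1 : 1 ≤ Bf := by rw [hBf]; exact le_trans (le_max_left _ _) (le_max_left _ _)
  have hBf0 : 0 < Bf := lt_of_lt_of_le one_pos hBf1
  have hBfs : 4 * φ₀ * t₀ * sCB ≤ Bf := by rw [hBf]; exact le_max_right _ _
  have hyP0 : 0 ≤ yP := by rw [hyP]; positivity
  have hyL0 : 0 < yL := by rw [hyL]; positivity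
  have haP0 : 0 ≤ aP := by rw [haP]; positivity
  have haA0 : 0 ≤ aA := by rw [haA]; positivity
  have haL0 : 0 < aL := by rw [haL]; positivity
  have hi₃c0 : 0 ≤ i₃c := by rw [hi₃c]; positivity
  have hsC0 : 0 ≤ sC := by rw [hsC]; positivity
  have hSfive0 : 0 ≤ Sfive := by rw [hSfive]; positivity
  have hR₆0 : 0 ≤ R₆ := by rw [hR₆]; positivity
  have hR₇0 : 0 ≤ R₇ := by rw [hR₇]; positivity
  have huf0 : 0 < uf := by rw [huf]; positivity
  have hqT0 : 0 ≤ qT := by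
    rw [hqT]; have : 0 ≤ Dinc := le_trans zero_le_one hDinc
    positivity
  have hCEf0 : 0 ≤ CEf := by rw [hCEf]; exact mul_nonneg (mul_nonneg hqT0 hBf0.le) (le_trans zero_le_one (le_max_left _ _))
  -- the `Bf`-scalings: `yP ≤ yB/Bf`, `aP ≤ aPB/Bf`, `i₃c ≤ i₃B/Bf`, `sC ≤ sCB/Bf`, hence `φ₀t₀·sC ≤ 1/4`
  have hBf2 : Bf ≤ Bf ^ 2 := by
    calc Bf = Bf * 1 := (mul_one _).symm
      _ ≤ Bf * Bf := mul_le_mul_of_nonneg_left hBf1 hBf0.le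
      _ = Bf ^ 2 := (sq Bf).symm
  have hyPB : yP ≤ yB / Bf := by
    rw [hyP, hyB, add_div, add_div]
    refine add_le_add (add_le_add (le_of_eq (by rw [div_div]; ring)) ?_) ?_
    · rw [div_div]
      refine div_le_div_of_nonneg_left (by positivity) (by positivity) ?_
      calc 4 * QL ^ 2 * Bf ≤ 4 * QL ^ 2 * Bf ^ 2 := by gcongr
        _ = 4 * Bf ^ 2 * QL ^ 2 := by ring
    · rw [div_div]
      refine div_le_div_of_nonneg_left (by positivity) (by positivity) ?_
      calc 2 * Bf ≤ 2 * Bf ^ 2 := by gcongr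
        _ = 2 * Bf ^ 2 := rfl
  have haPB' : aP ≤ aPB / Bf := by
    rw [haP, haPB, add_div]
    refine add_le_add ?_ ?_
    · exact div_le_div_of_nonneg_left (by positivity) hBf0 hBf2
    · calc 2 * yP / QL ≤ 2 * (yB / Bf) / QL := by gcongr
        _ = 2 * yB / QL / Bf := by field_simp
  have hi₃cB : i₃c ≤ i₃B / Bf := by
    rw [hi₃c, hi₃B, add_div]
    refine add_le_add (div_le_div_of_nonneg_left (by positivity) hBf0 hBf2) ?_
    calc aP * QH ^ 3 ≤ aPB / Bf * QH ^ 3 := by gcongr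
      _ = aPB * QH ^ 3 / Bf := by field_simp
  have hsCB' : sC ≤ sCB / Bf := by
    rw [hsC, hsCB, add_div, add_div]
    refine add_le_add (add_le_add (le_of_eq (by rw [div_div]; ring)) ?_) ?_
    · calc i₃c / (4 * QL ^ 2) ≤ i₃B / Bf / (4 * QL ^ 2) := by gcongr
        _ = i₃B / (4 * QL ^ 2) / Bf := by rw [div_right_comm]
    · calc aP * QH / 4 ≤ aPB / Bf * QH / 4 := by gcongr
        _ = aPB * QH / 4 / Bf := by field_simp
  have hsmall : φ₀ * t₀ * sC ≤ 1 / 4 := by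
    have h1 : φ₀ * t₀ * sC ≤ φ₀ * t₀ * (sCB / Bf) := by gcongr
    have h2 : φ₀ * t₀ * (sCB / Bf) ≤ 1 / 4 := by
      rw [mul_div_assoc', div_le_iff₀ hBf0]
      calc φ₀ * t₀ * sCB = (4 * φ₀ * t₀ * sCB) / 4 := by ring
        _ ≤ Bf / 4 := div_le_div_of_nonneg_right hBfs (by norm_num)
        _ = 1 / 4 * Bf := by ring
    exact h1.trans h2
  refine ⟨hBf1, huf0, hCEf0, ?_⟩
  -- §1 the binders
  intro β M _ hβ hβM U hU hUuf Ab Qb ι₂ X hAb hQb hι₂0 hι₂ hX0 hX Ab' ι₂' X' hAb' hι₂' hX' κb αb crb ccb hκb hαb hcrb hccb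
    W Z σ Φ ψ τ ι₁ hW hZ hσ hΦ hψ hτ hι₁0 hι₁ ρk Q' Q κA Yb Y A A' ι₃ hρk hQ' hQ hκA hYb hY hA hA' hι₃
  have hM0 : (0 : ℝ) < M := Nat.cast_pos.2 (Nat.pos_of_ne_zero (NeZero.ne M))
  have hβ0 : β ≠ 0 := hβ.ne'
  have hMne : (M : ℝ) ≠ 0 := hM0.ne'
  set r : ℝ := β / M with hr
  have hr0 : 0 < r := by positivity
  have hr1 : r ≤ 1 := by rw [hr, div_le_one hM0]; exact hβM
  have hMβ : (M : ℝ) / β = 1 / r := by rw [hr]; field_simp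
  have hMβ2 : ((M : ℝ) / β) ^ 2 = 1 / r ^ 2 := by rw [hMβ]; field_simp
  have hitw : imagTimeWeight β M = r / 2 := by rw [imagTimeWeight, hr]; field_simp
  -- uf below each of its members
  have huf1 : uf ≤ 1 := by rw [huf]; exact min_le_left _ _
  have huf2 : uf ≤ 1 / (8 * s₀ * QH + 1) := by rw [huf]; exact (min_le_right _ _).trans (min_le_left _ _)
  have huf4 : uf ≤ 1 / (4 * φ₀ * t₀ * i₁ + 1) := by
    rw [huf]; exact (min_le_right _ _).trans ((min_le_right _ _).trans ((min_le_right _ _).trans (min_le_left _ _)))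
  -- §2 the pins in closed form, then eliminate `W Z σ Φ ψ τ ρk κA`
  have hW' : W = W₀ := by rw [hW₀]; exact levPin_W hCJ.ne' hβ0 hMne hcrb hccb hW
  have hZ' : Z = Z₀ := by rw [hZ₀]; exact levPin_Z hβ0 hMne hccb hZ
  have hσ' : σ = s₀ * r ^ 2 := by rw [hs₀, hr]; exact levPin_σ hCκ hCJ.ne' hβ0 hMne hκb hccb hσ
  have hτ' : τ = t₀ * r ^ 2 := by rw [ht₀, hr]; exact levPin_τ hCκ hCJ.ne' hβ0 hMne hκb hccb hτ
  have hψ' : ψ = p₀ / r ^ 2 := by rw [levPin_ψ hCκ hCJ.ne' hβ0 hMne hκb hccb hψ, hMβ2, hp₀]; ring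
  have hΦ' : Φ = φ₀ / r := by rw [levPin_Φ hCκ hCJ.ne' hβ0 hMne hκb hαb hcrb hccb hΦ, hMβ, hφ₀]; ring
  have hρk' : ρk = ρk₀ := by rw [hρk, hρk₀]; exact levPin_ρk hCκ hCJ.ne' hβ0 hMne hκb hccb hψ hτ
  clear hW hZ hσ hτ hψ hΦ hρk
  subst W Z σ Φ ψ τ ρk
  have hκA' : κA = κA₀ := by rw [hκA, hκA₀]
  clear hκA
  subst κA
  -- §3 the base datum's shaped rows: `Ab = ab·r`, `Qb = qb/r²`, hence `Q′` two-sided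
  have hAb2 : Ab = ab * r := by rw [hAb, hr]
  clear hAb
  subst Ab
  have hQb2 : Qb = qb / r ^ 2 := by rw [hQb, hMβ2]; ring
  have hQb0 : 0 ≤ Qb := by rw [hQb2]; positivity
  have hQbhi : Qb ≤ qb / r ^ 2 := le_of_eq hQb2
  have hr2 : 0 < r ^ 2 := by positivity
  have hQ'₁ : QL / r ^ 2 ≤ Q' := by rw [hQ', hQL, hQb2]; rw [mul_div_assoc]; linarith
  have hZq : 0 ≤ Z₀ * (qb / r ^ 2) := by positivity
  have hQ'1 : 1 ≤ Q' := by rw [hQ', hQb2]; linarith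
  have hQ'₂ : Q' ≤ QH / r ^ 2 := by
    have h1 : (1 : ℝ) ≤ 1 / r ^ 2 := by rw [le_div_iff₀ hr2, one_mul]; exact pow_le_one₀ hr0.le hr1
    rw [hQ', hQH, hQb2, add_div, mul_div_assoc]; linarith
  have hQ'0 : 0 < Q' := lt_of_lt_of_le one_pos hQ'1
  have hι₁r : ι₁ ≤ i₁ / r := by rw [hMβ, mul_one_div] at hι₁; exact hι₁
  have hι₂r : ι₂ ≤ i₂ / r ^ 3 := by
    have : ((M : ℝ) / β) ^ 3 = 1 / r ^ 3 := by rw [hMβ]; field_simp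
    rw [this, mul_one_div] at hι₂; exact hι₂
  have hXr : X ≤ x₆ / r ^ 5 := by
    have : ((M : ℝ) / β) ^ 5 = 1 / r ^ 5 := by rw [hMβ]; field_simp
    rw [this, mul_one_div] at hX; exact hX
  have hι₂'0 : 0 ≤ ι₂' := by rw [hι₂']; positivity
  have hι₂'r : ι₂' ≤ i₂ / (Bf * r ^ 3) := by
    rw [hι₂', div_le_iff₀ hBf0]
    calc ι₂ ≤ i₂ / r ^ 3 := hι₂r
      _ = i₂ / (Bf * r ^ 3) * Bf := by field_simp
  have hX'0 : 0 ≤ X' := by rw [hX']; positivity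
  have hX'r : X' ≤ x₆ / (Bf ^ 2 * r ^ 5) := by
    rw [hX', div_le_iff₀ (by positivity)]
    calc X ≤ x₆ / r ^ 5 := hXr
      _ = x₆ / (Bf ^ 2 * r ^ 5) * Bf ^ 2 := by field_simp
  have hYb0 : 0 ≤ Yb := by rw [hYb]; positivity
  have hYb_le := levNum_Yb_le hr0 hW₀0.le hZ₀0.le hκA₀0.le hab0.le hQL0 hQ'₁ hQ'₂ hι₂0 hι₂r hX0 hXr rfl hYb
  rw [← hyB] at hYb_le
  obtain ⟨hY₁, hY₂⟩ := levNum_Y_bounds hr0 hW₀0.le hZ₀0.le hκA₀0.le hab0.le hBf1 hQL0 hQ'₁ hQ'₂ hι₂'0 hι₂'r hX'0 hX'r hAb' hY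
  rw [← hyL] at hY₁
  rw [← hyP] at hY₂
  have hY0 : 0 ≤ Y := le_trans (by positivity) hY₁
  obtain ⟨hA₁, hA₂⟩ := levNum_A_bounds hr0 hd hκA₀0 hQL0 hyL0.le hY₁ hY₂ hQ'₁ hQ'₂ hA
  rw [← haL] at hA₁
  rw [← haA] at hA₂
  have hA0 : 0 ≤ A := le_trans (by positivity) hA₁
  obtain ⟨hA'0, hA'₂⟩ := levNum_A'_bounds hr0 hW₀0.le hκA₀0.le hab0.le hBf1 hQL0 hY0 hY₂ hQ'₁ hAb' hA'
  rw [← haP] at hA'₂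
  have hι₃0 : 0 ≤ ι₃ := by rw [hι₃]; positivity
  have hι₃r := levNum_ι₃_le hr0 hW₀0.le hZ₀0.le hBf1 hX'r hA'0 hA'₂ hQ'0 hQ'₂ hι₃
  rw [← hi₃c] at hι₃r
  refine ⟨?_, ?_, ?_⟩
  -- (ii) the row `B ≥ B₀`
  · have h := levNum_Brow_le hr0 ht₀0.le hp₀0.le hφ₀0.le rfl rfl rfl hYb0 hYb_le hd hρk₀0 hκA₀0.le
    exact h.trans (by rw [hBf]; exact le_max_left _ _)
  -- (iii) the doors
  · have h2 := levNum_door2 (QH := QH) hr0 hs₀0.le rfl hQ'0 hQ'₂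
    have h3 := levNum_door3 (QH := QH) hr0 ht₀0.le rfl hQ'0 hQ'₂
    have h4 := levNum_door4 hr0 hφ₀0.le ht₀0.le rfl rfl hι₁0 hι₁r
    have h5 := (levNum_door5 hr0 hφ₀0.le ht₀0.le hBf1 rfl rfl hι₁0 hι₁r hι₂'0 hι₂'r hι₃0 hι₃r hA'0 hA'₂ hQ'0 hQ'₂).2
    rw [← hSfive] at h5
    have h6 := levNum_door6 hr0 hs₀0.le rfl hQ'0 hQ'₂ haL0 hA₁ hA'0 hA'₂ hρk₀0 hQ
    rw [← hR₆] at h6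
    have h7 := levNum_door7 (t₀ := t₀) hr0 hp₀0.le hφ₀0.le rfl rfl rfl hι₁0 hι₁r hQL0 hQ'₁ hQ'₂ haL0 hA₁ hρk₀0 hQ
    rw [← hR₇] at h7
    have hbig : uf ≤ min 1 (min (1 / (8 * s₀ * QH + 1)) (min (1 / (2 * exp 1 * t₀ * QH + 1)) (min (1 / (4 * φ₀ * t₀ * i₁ + 1))
        (min (1 / (2 * Sfive + 1)) (min (1 / (R₆ + 1)) (1 / (R₇ + 1))))))) := le_of_eq huf
    exact hbig.trans (min_le_min le_rfl (min_le_min h2 (min_le_min h3 (min_le_min h4 (min_le_min h5 (min_le_min h6 h7))))))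
  -- (iv) the CE♯ row
  · intro lam hlam0 hlamuf Aro Qro Qtot Atot hAro hQro hQtot hAtot
    have hlam1 : lam ≤ 1 := hlamuf.trans huf1
    have hlam2 : lam ≤ 1 / (8 * s₀ * QH + 1) := hlamuf.trans huf2
    have hlam4 : lam ≤ 1 / (4 * φ₀ * t₀ * i₁ + 1) := hlamuf.trans huf4
    obtain ⟨_, hx₁⟩ := levNum_x₁_le hr0 hs₀0.le rfl hQ'0 hQ'₂ hlam0 hlam2
    have hS := levNum_S_le hr0 hBf1 hQL0 hlam0 hι₁r hι₂'0 hι₂'r hι₃0 hι₃r hA'0 hA'₂ hQ'₁ hQ'₂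
    have hS2 : ι₁ * lam + ι₂' / (2 * Q') + ι₃ / (4 * Q' ^ 2) + A' * Q' / 4 ≤ (i₁ * lam + sC) / r := by
      rw [hsC]; exact hS.trans (le_of_eq (by ring))
    have hS0 : 0 ≤ ι₁ * lam + ι₂' / (2 * Q') + ι₃ / (4 * Q' ^ 2) + A' * Q' / 4 := by positivity
    have hS' : ι₁ * lam + ι₂' / (2 * Q') + ι₃ / (4 * Q' ^ 2) + A' * Q' / 4 ≤ (i₁ + sC) / r :=
      hS2.trans (div_le_div_of_nonneg_right (add_le_add (mul_le_of_le_one_right hi₁ hlam1) le_rfl) hr0.le)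
    obtain ⟨_, hy⟩ := levNum_y_le hr0 ht₀0.le hφ₀0.le rfl rfl hS0 hS2 hi₁ hlam4 hsmall
    have hτ0 : 0 < t₀ * r ^ 2 := by positivity
    have hAt := levNum_Atot_le hr0 hτ0 hQL0 hQ'₁ hS0 hS' hx₁ hy hA0 hA₂ hA'0 hA'₂ hAb' hC₁'.le hC₂' hCinc.le hd hAro hAtot
    rw [← haT] at hAt
    obtain ⟨hQtot0, hQt⟩ := levNum_Qtot_le hr0 hr1 ht₀0.le hp₀0.le rfl rfl hQ'0 hQ'₂ hQb0 hQbhi hρk₀0 hQ hDinc hQro hQtot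
    rw [← hqT] at hQt
    rw [hitw, hCEf]
    exact levNum_CErow_le hr0 hBf1 hQtot0 hQt hAt

end Summit.HubbardSuperconductivity.HubbardSuperconductivity.Theorems.EngineV8

end
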